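import Summits.RiemannHypothesis.RiemannHypothesis.Theorems.GroundBartaPolarPerronFrobeniusCruxBridge
import HarnessLib

/-!
# `EvenOneSignedWindows` — the CONTINUITY ROUTE, typed (pub-rhpf-pf, PF.md §5.6)

**long-odds MECHANISM SEARCH; no RH claims.**  This file is the kernel-checked SHAPE of the
"persistence along the window" argument of PF.md §5.6, nothing more: the topology is trivial
(real induction on `a`), and the entire content sits in the two analytic hypotheses, which are
NOT proved here and are not known for the Weil form:

* `hup`  — NO ZERO BIRTH just above a one-signed window: if the window `a` carries a one-signed
  even-sector ground state then so do all windows `b ∈ [a, a + δ)` for some `δ > 0` (channels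
  (E) edge, (I) interior, (M) mode switching of PF.md §5.6 all excluded locally);
* `hlim` — CONTINUITY FROM BELOW: if every window `b ∈ [a₀, a)` carries a one-signed even ground
  state then so does `a` (stability of one-signed ground states under increasing limits of the
  window; plausible from `L²`-compactness of ground states plus simplicity, not proved).

Given a starting window `a₀` (THEOREM-level only in the small-window Markov regime) these give a
one-signed even ground state on EVERY window `a ≥ a₀`, hence cofinally, hence
`EvenSectorBarta.EvenOneSignedWindows` by the tree's `evenOneSignedWindows_iff_cofinal`.

Declarations: `OneSignedWindow a` (the window predicate), `real_induction_Ici` (the induction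
principle on `[a₀, ∞)`), `forall_oneSignedWindow_of_continuityRoute`,
`evenOneSignedWindows_of_continuityRoute`.
-/

set_option linter.dupNamespace false

noncomputable section

open MeasureTheory Set Filter Complex
open scoped Real Topology

namespace Summit.RiemannHypothesis.RiemannHypothesis.Theorems.PolarPerronFrobenius

open Literature.NumberTheory.LFunctions

/-- The window `[-a, a]` carries a ONE-SIGNED even-sector ground state (the conjunct of
`evenOneSignedWindows_iff_cofinal`). -/
def OneSignedWindow (a : ℝ) : Prop :=
  ∃ u : ℝ → ℂ, IsWeilEvenGroundState a u ∧ ∀ᵐ t : ℝ, t ∈ Ioo (-a) a → (u t).im = 0 ∧ 0 ≤ (u t).re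

/-- **Real induction on `[a₀, ∞)`**: a predicate holding at `a₀`, propagating to a right
neighbourhood of every point where it holds, and stable under limits from below, holds on all of
`[a₀, ∞)`. -/
theorem real_induction_Ici {P : ℝ → Prop} {a₀ : ℝ} (hstart : P a₀)
    (hup : ∀ a, a₀ ≤ a → P a → ∃ δ > 0, ∀ b, a ≤ b → b < a + δ → P b)
    (hlim : ∀ a, a₀ < a → (∀ b, a₀ ≤ b → b < a → P b) → P a) :
    ∀ a, a₀ ≤ a → P a := by
  by_contra hcon
  push Not at hcon
  -- the set of bad points at or above `a₀`
  set B : Set ℝ := {a | a₀ ≤ a ∧ ¬ P a} with hB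
  have hBne : B.Nonempty := by
    obtain ⟨a, ha, hPa⟩ := hcon
    exact ⟨a, ha, hPa⟩
  have hBbdd : BddBelow B := ⟨a₀, fun x hx ↦ hx.1⟩
  set c := sInf B with hc
  have hc₀ : a₀ ≤ c := le_csInf hBne fun x hx ↦ hx.1
  -- everything in `[a₀, c)` is good
  have hgood : ∀ b, a₀ ≤ b → b < c → P b := by
    intro b hb hbc
    by_contra hPb
    have : c ≤ b := csInf_le hBbdd ⟨hb, hPb⟩
    exact absurd hbc (not_lt.2 this)
  -- `c` itself is good
  have hPc : P c := by
    rcases eq_or_lt_of_le hc₀ with h | h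
    · rw [← h]; exact hstart
    · exact hlim c h hgood
  -- hence a right neighbourhood of `c` is good, contradicting `c = inf B`
  obtain ⟨δ, hδ, hnbhd⟩ := hup c hc₀ hPc
  have hlower : ∀ x ∈ B, c + δ ≤ x := by
    intro x hx
    by_contra hlt
    push Not at hlt
    have hcx : c ≤ x := csInf_le hBbdd hx
    exact hx.2 (hnbhd x hcx hlt)
  have : c + δ ≤ c := le_csInf hBne hlower
  linarith

/-- The continuity route, typed: starting window + no zero birth above one-signed windows +
continuity from below ⇒ every window `a ≥ a₀` is one-signed. -/
theorem forall_oneSignedWindow_of_continuityRoute {a₀ : ℝ} (hstart : OneSignedWindow a₀)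
    (hup : ∀ a, a₀ ≤ a → OneSignedWindow a → ∃ δ > 0, ∀ b, a ≤ b → b < a + δ → OneSignedWindow b)
    (hlim : ∀ a, a₀ < a → (∀ b, a₀ ≤ b → b < a → OneSignedWindow b) → OneSignedWindow a) :
    ∀ a, a₀ ≤ a → OneSignedWindow a :=
  real_induction_Ici hstart hup hlim

/-- **The continuity route closes the crux** (given its two analytic inputs): under `hstart`,
`hup`, `hlim` the even-sector one-signed-windows statement
`EvenSectorBarta.EvenOneSignedWindows` holds. -/
theorem evenOneSignedWindows_of_continuityRoute {a₀ : ℝ} (hstart : OneSignedWindow a₀)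
    (hup : ∀ a, a₀ ≤ a → OneSignedWindow a → ∃ δ > 0, ∀ b, a ≤ b → b < a + δ → OneSignedWindow b)
    (hlim : ∀ a, a₀ < a → (∀ b, a₀ ≤ b → b < a → OneSignedWindow b) → OneSignedWindow a) :
    Summit.RiemannHypothesis.RiemannHypothesis.Theses.EvenSectorBarta.EvenOneSignedWindows := by
  refine evenOneSignedWindows_iff_cofinal.2 fun A ↦ ?_
  refine ⟨max A a₀, le_max_left _ _, ?_⟩
  obtain ⟨u, hu, hsign⟩ :=
    forall_oneSignedWindow_of_continuityRoute hstart hup hlim (max A a₀) (le_max_right _ _)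
  exact ⟨u, hu, hsign⟩

end Summit.RiemannHypothesis.RiemannHypothesis.Theorems.PolarPerronFrobenius

end
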